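import Literature.MathematicalPhysics.QuantumFieldTheory.QCDOS
import HarnessLib

/-!
# Vector flavour symmetry of lattice QCD observables: `flavourScale`, `IsFlavourNeutral`,
# `HasNeutralLatticeMassGap`

The neutral-sector vocabulary used next to `QCDScheme.HasLatticeMassGap` (file `QCDOS.lean`).

* `QCDLatticeObservable.flavourScale t` — the action of the **vector flavour torus**
  `t ∈ (ℂˣ)^{N_f}` on the boxed quark Grassmann algebra `BoxFermiAlg N_f R`: the algebra
  endomorphism induced on generators by `ψ̄_{f,…} ↦ t_f⁻¹ ψ̄_{f,…}`, `ψ_{f,…} ↦ t_f ψ_{f,…}`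
  (Montvay–Münster (5.6): for equal masses the Wilson action has the exact global `U(N_f)`
  symmetry `ψ ↦ U⁻¹ψ`, `ψ̄ ↦ ψ̄U`; for arbitrary masses its diagonal torus `U = diag(t)⁻¹`
  survives, because the Wilson–Dirac matrix is flavour-diagonal). Written, as in
  `fermiGaugeLin`, as `ExteriorAlgebra.map` of the diagonal linear map of generator coefficients.
* `QCDLatticeObservable.IsFlavourNeutral A` — `A.F U` is fixed by every `flavourScale t`,
  `t_f ≠ 0`: every flavour number (hence the baryon number) of `A` vanishes.
* `QCDScheme.HasNeutralLatticeMassGap sch Δ` — verbatim the body of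
  `QCDScheme.HasLatticeMassGap` restricted to pairs of flavour-neutral observables.
* `fermiFlavourScale t` — the same torus acting on the quark Grassmann algebra `FermiAlg N_f S`
  of a periodic torus (where the Berezin integral and the Boltzmann factor live).

The bodies of `flavourScale`, `IsFlavourNeutral`, `HasNeutralLatticeMassGap` are literally the
inline sub-terms of the route statements they abbreviate (so those unfold by `Iff.rfl`).

API and results (all proved):
* generic Grassmann facts — a diagonal rescaling `θ_i ↦ c_i θ_i` of the generators multiplies
  the monomial `θ_A` by `∏_{a∈A} c_a` (`exteriorMap_diag_grassmannBasis`) and the Berezin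
  integral by `∏_i c_i` (`berezin_exteriorMap_diag`); `IsNilpotent.exp` commutes with injective
  ring homomorphisms (`map_isNilpotentExp_of_injective`);
* values on generators (`flavourScale_psiBar`, `flavourScale_psi`), the group law
  (`flavourScale_mul`, `flavourScale_one`, `flavourScale_injective`), closure of the fixed points
  under the algebra operations, neutrality of same-flavour bilinears `ψ̄_{f,u} ψ_{f,u'}`,
  `one_isFlavourNeutral`, invariance of the boxed Berezin pairing (`berezin_flavourScale`);
* `HasLatticeMassGap Δ → HasNeutralLatticeMassGap Δ` (`.neutral`), monotonicity in `Δ` (`.mono`);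
* **exact vector flavour symmetry of lattice QCD** on every torus, at every `β` and for ALL
  (flavour-dependent) bare masses: the Berezin integral (`fermiIntegral_fermiFlavourScale`) and
  the Boltzmann factor `exp(−ψ̄D(U)ψ)` (`fermiFlavourScale_fermiBoltzmann`, `D` flavour-diagonal)
  are invariant, hence `⟨t · X⟩ = ⟨X⟩` (`qcdTorusExpect_fermiFlavourScale`) and the selection
  rule `⟨X⟩ = 0` for `X` of non-zero flavour charge (`qcdTorusExpect_eq_zero_of_fermiFlavourScale`);
  the torus placement `onTorus` intertwines the actions (`fermiFlavourScale_onTorus`), so a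
  neutral observable stays fixed on every torus (`IsFlavourNeutral.fermiFlavourScale_onTorus`).

Sources: I. Montvay, G. Münster, *Quantum Fields on a Lattice* (CUP 1994), §5.1.1, eq. (5.6)
(flavour symmetry of Wilson lattice QCD); K. Osterwalder, E. Seiler, Ann. Phys. 110 (1978) 440,
§2 (the algebra of gauge-invariant local lattice observables); F. A. Berezin, *The Method of
Second Quantization* (1966), Ch. I §3 (Grassmann algebra automorphisms induced by linear maps
of the generators).

Not here: the non-abelian `SU(N_f)_V` (needs equal masses), axial transformations, the
product / adjoint structure on `QCDLatticeObservable` (boundedness of products needs the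
non-degenerate Berezin pairing).
-/

open Filter
open Literature.MathematicalPhysics.QuantumLattice Literature.Probability.LatticeModels

noncomputable section

namespace Literature.MathematicalPhysics.QuantumFieldTheory

/-! ### Diagonal rescaling of Grassmann generators (generic) -/

section Diagonal

variable {K : Type*} [CommRing K] {ι : Type*}

/-- The diagonal map of coefficients on a basis vector: `e_i ↦ c_i e_i`. [folklore] -/
theorem pi_diag_single [DecidableEq ι] (c : ι → K) (i : ι) :
    (LinearMap.pi fun w => c w • (LinearMap.proj w : (ι → K) →ₗ[K] K)) (Pi.single i 1) =
      c i • Pi.single i 1 := by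
  funext w
  simp only [LinearMap.pi_apply, LinearMap.smul_apply, LinearMap.proj_apply, Pi.smul_apply,
    smul_eq_mul]
  by_cases h : w = i
  · subst h; simp
  · simp [Pi.single_eq_of_ne h]

/-- The algebra endomorphism of a Grassmann algebra induced by the diagonal map
`e_w ↦ c_w e_w` of generator coefficients multiplies the generator `θ_i` by `c_i`. [cite: Berezin1966, Ch. I §3] -/
theorem exteriorMap_diag_gen [DecidableEq ι] (c : ι → K) (i : ι) :
    ExteriorAlgebra.map (LinearMap.pi fun w => c w • (LinearMap.proj w : (ι → K) →ₗ[K] K))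
        (GrassmannAlgebra.gen K i) = c i • GrassmannAlgebra.gen K i := by
  rw [GrassmannAlgebra.gen, ExteriorAlgebra.map_apply_ι, ← map_smul, pi_diag_single]

/-- Diagonal rescalings compose by pointwise multiplication of the weights. [cite: Berezin1966, Ch. I §3] -/
theorem exteriorMap_diag_comp (c d : ι → K) :
    (ExteriorAlgebra.map
          (LinearMap.pi fun w => c w • (LinearMap.proj w : (ι → K) →ₗ[K] K))).comp
        (ExteriorAlgebra.map
          (LinearMap.pi fun w => d w • (LinearMap.proj w : (ι → K) →ₗ[K] K))) =
      ExteriorAlgebra.map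
        (LinearMap.pi fun w => (c w * d w) • (LinearMap.proj w : (ι → K) →ₗ[K] K)) := by
  rw [ExteriorAlgebra.map_comp_map]
  congr 1
  refine LinearMap.ext fun x => funext fun w => ?_
  simp only [LinearMap.comp_apply, LinearMap.pi_apply, LinearMap.smul_apply,
    LinearMap.proj_apply, smul_eq_mul, mul_assoc]

/-- The diagonal rescaling with all weights `1` is the identity. [cite: Berezin1966, Ch. I §3] -/
theorem exteriorMap_diag_eq_id {c : ι → K} (hc : ∀ w, c w = 1) :
    ExteriorAlgebra.map (LinearMap.pi fun w => c w • (LinearMap.proj w : (ι → K) →ₗ[K] K)) =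
      AlgHom.id K (GrassmannAlgebra K ι) := by
  rw [← ExteriorAlgebra.map_id]
  congr 1
  refine LinearMap.ext fun x => funext fun w => ?_
  simp [LinearMap.pi_apply, hc w]

variable [LinearOrder ι] [Fintype ι]

/-- The monomial basis element `θ_A` as an `ιMulti` of basis vectors (Mathlib's
`ExteriorAlgebra.basis_apply`, unfolded). [cite: Berezin1966, Ch. I §3 (3.3)] -/
theorem grassmannBasis_eq_ιMulti (A : Finset ι) :
    GrassmannAlgebra.grassmannBasis K ι A =
      ExteriorAlgebra.ιMulti K A.card (fun k => Pi.basisFun K ι (A.orderEmbOfFin rfl k)) := by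
  rw [GrassmannAlgebra.grassmannBasis, ExteriorAlgebra.basis_apply]
  rfl

/-- A diagonal rescaling of the generators multiplies the monomial `θ_A` by `∏_{a ∈ A} c_a`. [cite: Berezin1966, Ch. I §3] -/
theorem exteriorMap_diag_grassmannBasis (c : ι → K) (A : Finset ι) :
    ExteriorAlgebra.map (LinearMap.pi fun w => c w • (LinearMap.proj w : (ι → K) →ₗ[K] K))
        (GrassmannAlgebra.grassmannBasis K ι A) =
      (∏ a ∈ A, c a) • GrassmannAlgebra.grassmannBasis K ι A := by
  classical
  rw [grassmannBasis_eq_ιMulti, ExteriorAlgebra.map_apply_ιMulti]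
  have key : (⇑(LinearMap.pi fun w => c w • (LinearMap.proj w : (ι → K) →ₗ[K] K)) ∘
        fun k => Pi.basisFun K ι (A.orderEmbOfFin rfl k)) =
      fun k => c (A.orderEmbOfFin rfl k) • Pi.basisFun K ι (A.orderEmbOfFin rfl k) := by
    funext k
    simp only [Function.comp_apply, Pi.basisFun_apply]
    convert pi_diag_single c (A.orderEmbOfFin rfl k) using 2
  rw [key, AlternatingMap.map_smul_univ, ← grassmannBasis_eq_ιMulti]
  congr 1
  calc ∏ k, c (A.orderEmbOfFin rfl k)
      = ∏ a ∈ Finset.univ.map (A.orderEmbOfFin rfl).toEmbedding, c a :=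
        (Finset.prod_map _ _ _).symm
    _ = ∏ a ∈ A, c a := by rw [Finset.map_orderEmbOfFin_univ]

/-- **The Berezin integral under a diagonal rescaling of the generators** picks up the product
of all weights: `∫dθ (θ_i ↦ c_i θ_i)(x) = (∏_i c_i) ∫dθ x` (the Berezin "Jacobian" is the
inverse determinant; here only the diagonal case). [cite: Berezin1966, Ch. I §3] -/
theorem berezin_exteriorMap_diag (c : ι → K) (x : GrassmannAlgebra K ι) :
    GrassmannAlgebra.berezin K ι
        (ExteriorAlgebra.map
          (LinearMap.pi fun w => c w • (LinearMap.proj w : (ι → K) →ₗ[K] K)) x) =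
      (∏ i, c i) * GrassmannAlgebra.berezin K ι x := by
  suffices h : (GrassmannAlgebra.berezin K ι).comp
      (ExteriorAlgebra.map (LinearMap.pi fun w => c w •
        (LinearMap.proj w : (ι → K) →ₗ[K] K))).toLinearMap =
      (∏ i, c i) • GrassmannAlgebra.berezin K ι from LinearMap.congr_fun h x
  refine (GrassmannAlgebra.grassmannBasis K ι).ext fun A => ?_
  simp only [LinearMap.comp_apply, AlgHom.toLinearMap_apply, LinearMap.smul_apply,
    exteriorMap_diag_grassmannBasis, map_smul, smul_eq_mul]
  by_cases hA : A = Finset.univ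
  · subst hA
    simp
  · simp [GrassmannAlgebra.berezin_grassmannBasis_of_ne K hA]

end Diagonal

/-- Case analysis on a lexicographic sum, through `toLex`. [folklore] -/
@[elab_as_elim]
theorem lex_sum_ind {α β : Type*} {P : α ⊕ₗ β → Prop} (hl : ∀ a, P (toLex (Sum.inl a)))
    (hr : ∀ b, P (toLex (Sum.inr b))) (w : α ⊕ₗ β) : P w := by
  obtain ⟨w, rfl⟩ := toLex.surjective w
  cases w with
  | inl a => exact hl a
  | inr b => exact hr b

/-- `IsNilpotent.exp` (a finite sum `∑_{i < nilpotency class} aⁱ/i!`) commutes with every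
INJECTIVE ring homomorphism — for all `a`, nilpotent or not, since an injective map preserves
the nilpotency class. [folklore] -/
theorem map_isNilpotentExp_of_injective {A B F : Type*} [Ring A] [Ring B] [Module ℚ A]
    [Module ℚ B] [FunLike F A B] [RingHomClass F A B] (f : F) (hf : Function.Injective f)
    (a : A) :
    f (IsNilpotent.exp a) = IsNilpotent.exp (f a) := by
  have hcl : nilpotencyClass (f a) = nilpotencyClass a := by
    simp only [nilpotencyClass, ← map_pow, map_eq_zero_iff f hf]
  simp only [IsNilpotent.exp, map_sum, map_rat_smul, map_pow, hcl]

variable {Nf R : ℕ}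

/-! ### The vector flavour torus on boxed quark variables -/

namespace QCDLatticeObservable

/-- The weight of the vector flavour torus `t ∈ (ℂˣ)^{N_f}` on a boxed generator: `t_f⁻¹` on
`ψ̄_{f,…}` (`Sum.inl`), `t_f` on `ψ_{f,…}` (`Sum.inr`). [cite: MontvayMunster1994, §5.1.1 (5.6)] -/
def flavourWeight (t : Fin Nf → ℂ) (w : BoxFermiIdx Nf R ⊕ₗ BoxFermiIdx Nf R) : ℂ :=
  match ofLex w with
  | Sum.inl i => (t (boxQuarkEquiv.symm i).1)⁻¹
  | Sum.inr i => t (boxQuarkEquiv.symm i).1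

/-- **The vector flavour torus `(ℂˣ)^{N_f}` acting on the boxed quark Grassmann algebra**:
the algebra endomorphism induced on generators by `ψ̄_{f,x,a,α} ↦ t_f⁻¹ ψ̄_{f,x,a,α}`,
`ψ_{f,x,a,α} ↦ t_f ψ_{f,x,a,α}` — the diagonal subgroup `U = diag(t)⁻¹` of Montvay–Münster's
`U(N_f)` flavour symmetry `ψ ↦ U⁻¹ψ`, `ψ̄ ↦ ψ̄U` of Wilson lattice QCD, which is exact for
ARBITRARY (flavour-diagonal) quark masses. For `t_f = 0` it is still defined (a non-invertible
endomorphism, junk). The body is literally the inline term of the route statements. [cite: MontvayMunster1994, §5.1.1 (5.6)] -/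
def flavourScale (t : Fin Nf → ℂ) : BoxFermiAlg Nf R →ₐ[ℂ] BoxFermiAlg Nf R :=
  ExteriorAlgebra.map (LinearMap.pi fun w : BoxFermiIdx Nf R ⊕ₗ BoxFermiIdx Nf R =>
    (match ofLex w with
      | Sum.inl i => (t (boxQuarkEquiv.symm i).1)⁻¹
      | Sum.inr i => t (boxQuarkEquiv.symm i).1) • LinearMap.proj w)

/-- **Flavour-neutral observable**: `A.F U` is fixed by the whole vector flavour torus, i.e.
every monomial of `A.F U` in the quark generators carries, for each flavour `f`, as many `ψ_f`
as `ψ̄_f` (all flavour numbers, hence the baryon number, vanish). Mesons `ψ̄_f Γ ψ_f`, Wilson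
loops and their products are neutral; `ψ̄_u γ₅ ψ_d` or a baryon `εψψψ` is not. [cite: MontvayMunster1994, §5.1.1 (5.6)] [cite: OsterwalderSeiler1978, §2] -/
def IsFlavourNeutral (A : QCDLatticeObservable Nf R) : Prop :=
  ∀ t : Fin Nf → ℂ, (∀ f, t f ≠ 0) → ∀ U, flavourScale t (A.F U) = A.F U

variable (t : Fin Nf → ℂ)

/-- The weight on `ψ̄`-generators. [cite: MontvayMunster1994, §5.1.1 (5.6)] -/
@[simp] theorem flavourWeight_inl (i : BoxFermiIdx Nf R) :
    flavourWeight t (toLex (Sum.inl i)) = (t (boxQuarkEquiv.symm i).1)⁻¹ := rfl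

/-- The weight on `ψ`-generators. [cite: MontvayMunster1994, §5.1.1 (5.6)] -/
@[simp] theorem flavourWeight_inr (i : BoxFermiIdx Nf R) :
    flavourWeight t (toLex (Sum.inr i)) = t (boxQuarkEquiv.symm i).1 := rfl

/-- `flavourScale t` is the diagonal rescaling of generators with weights `flavourWeight t`. [cite: MontvayMunster1994, §5.1.1 (5.6)] -/
theorem flavourScale_eq :
    flavourScale (R := R) t =
      ExteriorAlgebra.map (LinearMap.pi fun w => flavourWeight t w •
        (LinearMap.proj w : (BoxFermiIdx Nf R ⊕ₗ BoxFermiIdx Nf R → ℂ) →ₗ[ℂ] ℂ)) :=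
  rfl

/-- `ψ̄_{f,u} ↦ t_f⁻¹ ψ̄_{f,u}`. [cite: MontvayMunster1994, §5.1.1 (5.6)] -/
@[simp] theorem flavourScale_psiBar (v : BoxQuarkVar Nf R) :
    flavourScale t (psiBar ℂ (boxQuarkEquiv v)) =
      (t v.1)⁻¹ • psiBar ℂ (boxQuarkEquiv v) := by
  rw [flavourScale_eq, psiBar, exteriorMap_diag_gen, flavourWeight_inl, Equiv.symm_apply_apply]

/-- `ψ_{f,u} ↦ t_f ψ_{f,u}`. [cite: MontvayMunster1994, §5.1.1 (5.6)] -/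
@[simp] theorem flavourScale_psi (v : BoxQuarkVar Nf R) :
    flavourScale t (psi ℂ (boxQuarkEquiv v)) = t v.1 • psi ℂ (boxQuarkEquiv v) := by
  rw [flavourScale_eq, psi, exteriorMap_diag_gen, flavourWeight_inr, Equiv.symm_apply_apply]

/-- The weights are multiplicative in `t`. [cite: MontvayMunster1994, §5.1.1 (5.6)] -/
theorem flavourWeight_mul (s t : Fin Nf → ℂ) (w : BoxFermiIdx Nf R ⊕ₗ BoxFermiIdx Nf R) :
    flavourWeight (s * t) w = flavourWeight s w * flavourWeight t w := by
  induction w using lex_sum_ind with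
  | hl a => simp [mul_comm]
  | hr b => simp

/-- The unit has all weights `1`. [cite: MontvayMunster1994, §5.1.1 (5.6)] -/
theorem flavourWeight_one (w : BoxFermiIdx Nf R ⊕ₗ BoxFermiIdx Nf R) :
    flavourWeight (1 : Fin Nf → ℂ) w = 1 := by
  induction w using lex_sum_ind with
  | hl a => simp
  | hr b => simp

/-- Group law of the torus action: `flavourScale (s * t) = flavourScale s ∘ flavourScale t`. [cite: MontvayMunster1994, §5.1.1 (5.6)] -/
theorem flavourScale_mul (s t : Fin Nf → ℂ) :
    flavourScale (R := R) (s * t) = (flavourScale s).comp (flavourScale t) := by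
  rw [flavourScale_eq, flavourScale_eq, flavourScale_eq, exteriorMap_diag_comp]
  congr 1
  refine LinearMap.ext fun x => funext fun w => ?_
  simp only [LinearMap.pi_apply, LinearMap.smul_apply, smul_eq_mul, flavourWeight_mul]

/-- The unit of the torus acts trivially. [cite: MontvayMunster1994, §5.1.1 (5.6)] -/
theorem flavourScale_one : flavourScale (R := R) (1 : Fin Nf → ℂ) = AlgHom.id ℂ _ := by
  rw [flavourScale_eq]
  exact exteriorMap_diag_eq_id flavourWeight_one

/-- For `t ∈ (ℂˣ)^{N_f}`, `flavourScale t⁻¹` inverts `flavourScale t`. [cite: MontvayMunster1994, §5.1.1 (5.6)] -/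
theorem flavourScale_inv_comp {t : Fin Nf → ℂ} (ht : ∀ f, t f ≠ 0) :
    (flavourScale (R := R) t⁻¹).comp (flavourScale t) = AlgHom.id ℂ _ := by
  rw [← flavourScale_mul, ← flavourScale_one]
  congr 1
  funext f
  simp [ht f]

/-- `flavourScale t` is injective for `t ∈ (ℂˣ)^{N_f}`. [cite: MontvayMunster1994, §5.1.1 (5.6)] -/
theorem flavourScale_injective {t : Fin Nf → ℂ} (ht : ∀ f, t f ≠ 0) :
    Function.Injective (flavourScale (R := R) t) := by
  intro x y hxy
  have h := congrArg (flavourScale (R := R) t⁻¹) hxy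
  rwa [← AlgHom.comp_apply, ← AlgHom.comp_apply, flavourScale_inv_comp ht] at h

/-- A same-flavour bilinear `ψ̄_{f,u} ψ_{f,u'}` is fixed by the torus (`t_f ≠ 0`). [cite: MontvayMunster1994, §5.1.1 (5.6)] -/
theorem flavourScale_psiBar_mul_psi {t : Fin Nf → ℂ} (f : Fin Nf) (hf : t f ≠ 0)
    (u u' : ↥(box 4 R) × Fin 3 × Fin 4) :
    flavourScale t (psiBar ℂ (boxQuarkEquiv (f, u)) * psi ℂ (boxQuarkEquiv (f, u'))) =
      psiBar ℂ (boxQuarkEquiv (f, u)) * psi ℂ (boxQuarkEquiv (f, u')) := by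
  rw [map_mul, flavourScale_psiBar, flavourScale_psi, smul_mul_smul_comm, inv_mul_cancel₀ hf,
    one_smul]

/-- Neutrality unfolds to membership of every `A.F U` in the fixed-point subalgebra
`AlgHom.equalizer (flavourScale t) id` for all `t ∈ (ℂˣ)^{N_f}`. [cite: MontvayMunster1994, §5.1.1 (5.6)] -/
theorem isFlavourNeutral_iff (A : QCDLatticeObservable Nf R) :
    A.IsFlavourNeutral ↔ ∀ t : Fin Nf → ℂ, (∀ f, t f ≠ 0) →
      ∀ U, A.F U ∈ AlgHom.equalizer (flavourScale t) (AlgHom.id ℂ (BoxFermiAlg Nf R)) :=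
  Iff.rfl

/-- Fixed points of `flavourScale t` are closed under products. [cite: MontvayMunster1994, §5.1.1 (5.6)] -/
theorem flavourScale_mul_of_eq {x y : BoxFermiAlg Nf R} (hx : flavourScale t x = x)
    (hy : flavourScale t y = y) : flavourScale t (x * y) = x * y := by
  rw [map_mul, hx, hy]

/-- Fixed points of `flavourScale t` are closed under sums. [cite: MontvayMunster1994, §5.1.1 (5.6)] -/
theorem flavourScale_add_of_eq {x y : BoxFermiAlg Nf R} (hx : flavourScale t x = x)
    (hy : flavourScale t y = y) : flavourScale t (x + y) = x + y := by
  rw [map_add, hx, hy]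

/-- Fixed points of `flavourScale t` are closed under scalars. [cite: MontvayMunster1994, §5.1.1 (5.6)] -/
theorem flavourScale_smul_of_eq (c : ℂ) {x : BoxFermiAlg Nf R} (hx : flavourScale t x = x) :
    flavourScale t (c • x) = c • x := by
  rw [map_smul, hx]

/-- Fixed points of `flavourScale t` are closed under finite sums. [cite: MontvayMunster1994, §5.1.1 (5.6)] -/
theorem flavourScale_sum_of_eq {α : Type*} (s : Finset α) {x : α → BoxFermiAlg Nf R}
    (hx : ∀ a ∈ s, flavourScale t (x a) = x a) :
    flavourScale t (∑ a ∈ s, x a) = ∑ a ∈ s, x a := by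
  rw [map_sum]
  exact Finset.sum_congr rfl hx

/-- Fixed points of `flavourScale t` are closed under finite products. [cite: MontvayMunster1994, §5.1.1 (5.6)] -/
theorem flavourScale_prod_of_eq (l : List (BoxFermiAlg Nf R))
    (hx : ∀ a ∈ l, flavourScale t a = a) : flavourScale t l.prod = l.prod := by
  induction l with
  | nil => simp
  | cons a l ih =>
    rw [List.prod_cons, map_mul, hx a (by simp), ih fun b hb => hx b (by simp [hb])]

variable (Nf R) in
/-- The unit observable is flavour-neutral (non-vacuity). [folklore] -/
theorem one_isFlavourNeutral : (one Nf R).IsFlavourNeutral :=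
  fun t _ _ => map_one (flavourScale t)

/-- The product of all box weights is `1` (as many `t_f⁻¹` as `t_f`). [cite: MontvayMunster1994, §4.1 (4.21)] -/
theorem prod_flavourWeight {t : Fin Nf → ℂ} (ht : ∀ f, t f ≠ 0) :
    ∏ w, flavourWeight (R := R) t w = 1 := by
  rw [← Fintype.prod_equiv toLex (fun w => flavourWeight (R := R) t (toLex w)) _
      fun _ => rfl, Fintype.prod_sum_type]
  simp only [flavourWeight_inl, flavourWeight_inr, ← Finset.prod_mul_distrib]
  exact Finset.prod_eq_one fun i _ => inv_mul_cancel₀ (ht _)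

/-- **The boxed Berezin integral (the pairing used in `QCDLatticeObservable.bounded` /
`measurable`) is invariant under the vector flavour torus.** [cite: MontvayMunster1994, §4.1 (4.21)] -/
theorem berezin_flavourScale {t : Fin Nf → ℂ} (ht : ∀ f, t f ≠ 0) (x : BoxFermiAlg Nf R) :
    GrassmannAlgebra.berezin ℂ (BoxFermiIdx Nf R ⊕ₗ BoxFermiIdx Nf R) (flavourScale t x) =
      GrassmannAlgebra.berezin ℂ (BoxFermiIdx Nf R ⊕ₗ BoxFermiIdx Nf R) x := by
  rw [flavourScale_eq, berezin_exteriorMap_diag, prod_flavourWeight ht, one_mul]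

end QCDLatticeObservable

/-! ### The neutral-sector lattice gap -/

/-- **Uniform lattice mass gap `Δ` in the flavour-neutral sector** — verbatim the body of
`QCDScheme.HasLatticeMassGap` restricted to pairs `A, B` of FLAVOUR-NEUTRAL gauge-invariant
local observables (all Wilson loops, all mesons `ψ̄_f Γ ψ_f`, glueball and flavour-singlet
channels; no flavoured mesons, no baryons): there is `C` such that for all large `k`, on every
torus of side `2S+1 ≥ 2L_k+1`, at the scheme's `β_k`, `m_f(k)`, and all Euclidean times `n ≤ S`,
`‖⟨A · τ_{n e₀}B⟩ − ⟨A⟩⟨B⟩‖ ≤ C e^{−Δ a_k n}`. [cite: JaffeWitten2000, §1 and §5] [cite: OsterwalderSeiler1978, §§2–4] -/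
def QCDScheme.HasNeutralLatticeMassGap (sch : QCDScheme Nf) (Δ : ℝ) : Prop :=
  ∀ (R R' : ℕ) (A : QCDLatticeObservable Nf R) (B : QCDLatticeObservable Nf R'),
    A.IsFlavourNeutral → B.IsFlavourNeutral → ∃ C : ℝ,
      ∀ᶠ k in atTop, ∀ S : ℕ, sch.L k ≤ S → ∀ n : ℕ, n ≤ S →
        ‖qcdLatticeConnectedCorr (sch.β k) (2 * S + 1) (fun fl => sch.mq fl k) A B n‖ ≤
          C * Real.exp (-(Δ * (sch.a k * n)))

/-- The full lattice gap restricts to the neutral sector. [folklore] -/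
theorem QCDScheme.HasLatticeMassGap.neutral {sch : QCDScheme Nf} {Δ : ℝ}
    (h : sch.HasLatticeMassGap Δ) : sch.HasNeutralLatticeMassGap Δ :=
  fun R R' A B _ _ => h R R' A B

/-- The neutral lattice gap is monotone in the rate: a gap `Δ` is a gap `Δ' ≤ Δ`. [folklore] -/
theorem QCDScheme.HasNeutralLatticeMassGap.mono {sch : QCDScheme Nf} {Δ Δ' : ℝ}
    (h : sch.HasNeutralLatticeMassGap Δ) (hΔ : Δ' ≤ Δ) :
    sch.HasNeutralLatticeMassGap Δ' := by
  intro R R' A B hA hB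
  obtain ⟨C, hC⟩ := h R R' A B hA hB
  refine ⟨max C 0, hC.mono fun k hk S hS n hn => (hk S hS n hn).trans ?_⟩
  have hx : 0 ≤ sch.a k * n := mul_nonneg (sch.a_pos k).le n.cast_nonneg
  calc C * Real.exp (-(Δ * (sch.a k * n)))
      ≤ max C 0 * Real.exp (-(Δ * (sch.a k * n))) :=
        mul_le_mul_of_nonneg_right (le_max_left _ _) (Real.exp_nonneg _)
    _ ≤ max C 0 * Real.exp (-(Δ' * (sch.a k * n))) :=
        mul_le_mul_of_nonneg_left (Real.exp_le_exp.2 (by nlinarith)) (le_max_right _ _)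

/-! ### The torus on the quark variables of a periodic torus -/

section Torus

variable {S : ℕ} [NeZero S]

/-- The weight of the vector flavour torus on a torus quark generator: `t_f⁻¹` on `ψ̄_{f,…}`,
`t_f` on `ψ_{f,…}`. [cite: MontvayMunster1994, §5.1.1 (5.6)] -/
def fermiFlavourWeight (t : Fin Nf → ℂ) (w : FermiIdx Nf S ⊕ₗ FermiIdx Nf S) : ℂ :=
  match ofLex w with
  | Sum.inl i => (t (quarkEquiv.symm i).1)⁻¹
  | Sum.inr i => t (quarkEquiv.symm i).1

/-- **The vector flavour torus acting on the quark Grassmann algebra of the torus of side `S`**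
(`ψ̄_f ↦ t_f⁻¹ ψ̄_f`, `ψ_f ↦ t_f ψ_f`), the symmetry of the flavour-diagonal Wilson–Dirac action
and of the Berezin measure. [cite: MontvayMunster1994, §5.1.1 (5.6)] -/
def fermiFlavourScale (t : Fin Nf → ℂ) : FermiAlg Nf S →ₐ[ℂ] FermiAlg Nf S :=
  ExteriorAlgebra.map (LinearMap.pi fun w => fermiFlavourWeight t w •
    (LinearMap.proj w : (FermiIdx Nf S ⊕ₗ FermiIdx Nf S → ℂ) →ₗ[ℂ] ℂ))

variable (t : Fin Nf → ℂ)

/-- The weight on `ψ̄`-generators. [cite: MontvayMunster1994, §5.1.1 (5.6)] -/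
@[simp] theorem fermiFlavourWeight_inl (i : FermiIdx Nf S) :
    fermiFlavourWeight t (toLex (Sum.inl i)) = (t (quarkEquiv.symm i).1)⁻¹ := rfl

/-- The weight on `ψ`-generators. [cite: MontvayMunster1994, §5.1.1 (5.6)] -/
@[simp] theorem fermiFlavourWeight_inr (i : FermiIdx Nf S) :
    fermiFlavourWeight t (toLex (Sum.inr i)) = t (quarkEquiv.symm i).1 := rfl

/-- `ψ̄_v ↦ t_{v.1}⁻¹ ψ̄_v`. [cite: MontvayMunster1994, §5.1.1 (5.6)] -/
@[simp] theorem fermiFlavourScale_qbar (v : QuarkVar Nf S) :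
    fermiFlavourScale t (qbar v) = (t v.1)⁻¹ • qbar v := by
  rw [qbar, fermiFlavourScale, psiBar, exteriorMap_diag_gen, fermiFlavourWeight_inl,
    Equiv.symm_apply_apply]

/-- `ψ_v ↦ t_{v.1} ψ_v`. [cite: MontvayMunster1994, §5.1.1 (5.6)] -/
@[simp] theorem fermiFlavourScale_q (v : QuarkVar Nf S) :
    fermiFlavourScale t (q v) = t v.1 • q v := by
  rw [q, fermiFlavourScale, psi, exteriorMap_diag_gen, fermiFlavourWeight_inr,
    Equiv.symm_apply_apply]

/-- The torus weights are multiplicative in `t`. [cite: MontvayMunster1994, §5.1.1 (5.6)] -/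
theorem fermiFlavourWeight_mul (s t : Fin Nf → ℂ) (w : FermiIdx Nf S ⊕ₗ FermiIdx Nf S) :
    fermiFlavourWeight (s * t) w = fermiFlavourWeight s w * fermiFlavourWeight t w := by
  induction w using lex_sum_ind with
  | hl a => simp [mul_comm]
  | hr b => simp

/-- The unit has all torus weights `1`. [cite: MontvayMunster1994, §5.1.1 (5.6)] -/
theorem fermiFlavourWeight_one (w : FermiIdx Nf S ⊕ₗ FermiIdx Nf S) :
    fermiFlavourWeight (1 : Fin Nf → ℂ) w = 1 := by
  induction w using lex_sum_ind with
  | hl a => simp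
  | hr b => simp

/-- Group law on the torus algebra. [cite: MontvayMunster1994, §5.1.1 (5.6)] -/
theorem fermiFlavourScale_mul (s t : Fin Nf → ℂ) :
    fermiFlavourScale (S := S) (s * t) = (fermiFlavourScale s).comp (fermiFlavourScale t) := by
  rw [fermiFlavourScale, fermiFlavourScale, fermiFlavourScale, exteriorMap_diag_comp]
  congr 1
  refine LinearMap.ext fun x => funext fun w => ?_
  simp only [LinearMap.pi_apply, LinearMap.smul_apply, smul_eq_mul, fermiFlavourWeight_mul]

/-- The unit acts trivially on the torus algebra. [cite: MontvayMunster1994, §5.1.1 (5.6)] -/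
theorem fermiFlavourScale_one : fermiFlavourScale (S := S) (1 : Fin Nf → ℂ) = AlgHom.id ℂ _ :=
  exteriorMap_diag_eq_id fermiFlavourWeight_one

/-- `fermiFlavourScale t` is injective for `t ∈ (ℂˣ)^{N_f}`. [cite: MontvayMunster1994, §5.1.1 (5.6)] -/
theorem fermiFlavourScale_injective {t : Fin Nf → ℂ} (ht : ∀ f, t f ≠ 0) :
    Function.Injective (fermiFlavourScale (S := S) t) := by
  have hcomp :
      (fermiFlavourScale (S := S) t⁻¹).comp (fermiFlavourScale t) = AlgHom.id ℂ _ := by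
    rw [← fermiFlavourScale_mul, ← fermiFlavourScale_one]
    congr 1
    funext f
    simp [ht f]
  intro x y hxy
  have h := congrArg (fermiFlavourScale (S := S) t⁻¹) hxy
  rwa [← AlgHom.comp_apply, ← AlgHom.comp_apply, hcomp] at h

/-- `ψ̄_i ↦ t_{f(i)}⁻¹ ψ̄_i` on enumerated generators. [cite: MontvayMunster1994, §5.1.1 (5.6)] -/
theorem fermiFlavourScale_psiBar (i : FermiIdx Nf S) :
    fermiFlavourScale t (psiBar ℂ i) = (t (quarkEquiv.symm i).1)⁻¹ • psiBar ℂ i := by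
  rw [fermiFlavourScale, psiBar, exteriorMap_diag_gen, fermiFlavourWeight_inl]

/-- `ψ_i ↦ t_{f(i)} ψ_i` on enumerated generators. [cite: MontvayMunster1994, §5.1.1 (5.6)] -/
theorem fermiFlavourScale_psi (i : FermiIdx Nf S) :
    fermiFlavourScale t (psi ℂ i) = t (quarkEquiv.symm i).1 • psi ℂ i := by
  rw [fermiFlavourScale, psi, exteriorMap_diag_gen, fermiFlavourWeight_inr]

/-- The product of all torus weights is `1` (as many `t_f⁻¹` as `t_f`): the Berezin measure
`dψ̄ dψ` (the top coefficient, Montvay–Münster (4.21)) is flavour-torus invariant. [cite: MontvayMunster1994, §4.1 (4.21)] -/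
theorem prod_fermiFlavourWeight {t : Fin Nf → ℂ} (ht : ∀ f, t f ≠ 0) :
    ∏ w, fermiFlavourWeight (S := S) t w = 1 := by
  rw [← Fintype.prod_equiv toLex (fun w => fermiFlavourWeight (S := S) t (toLex w)) _
      fun _ => rfl, Fintype.prod_sum_type]
  simp only [fermiFlavourWeight_inl, fermiFlavourWeight_inr, ← Finset.prod_mul_distrib]
  exact Finset.prod_eq_one fun i _ => inv_mul_cancel₀ (ht _)

/-- **Invariance of the Berezin integral** `∫dψ̄dψ` under the vector flavour torus. [cite: MontvayMunster1994, §4.1 and §5.1.1 (5.6)] -/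
theorem fermiIntegral_fermiFlavourScale {t : Fin Nf → ℂ} (ht : ∀ f, t f ≠ 0)
    (x : FermiAlg Nf S) :
    fermiIntegral (fermiFlavourScale t x) = fermiIntegral x := by
  rw [fermiIntegral, fermiFlavourScale, berezin_exteriorMap_diag, prod_fermiFlavourWeight ht,
    one_mul]

/-- A FLAVOUR-DIAGONAL bilinear `ψ̄Aψ` (`A_{ij} = 0` unless `i, j` carry the same flavour) is
fixed by the torus. [cite: MontvayMunster1994, §5.1.1 (5.6)] -/
theorem fermiFlavourScale_quadratic {t : Fin Nf → ℂ} (ht : ∀ f, t f ≠ 0)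
    (A : Matrix (FermiIdx Nf S) (FermiIdx Nf S) ℂ)
    (hA : ∀ i j, (quarkEquiv.symm i).1 ≠ (quarkEquiv.symm j).1 → A i j = 0) :
    fermiFlavourScale t (quadratic ℂ A) = quadratic ℂ A := by
  simp only [quadratic, map_sum, map_smul, map_mul, fermiFlavourScale_psiBar,
    fermiFlavourScale_psi, smul_mul_smul_comm]
  refine Finset.sum_congr rfl fun i _ => Finset.sum_congr rfl fun j _ => ?_
  by_cases hij : (quarkEquiv.symm i).1 = (quarkEquiv.symm j).1
  · rw [hij, inv_mul_cancel₀ (ht _), one_smul]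
  · rw [hA i j hij, zero_smul, zero_smul]

/-- The `N_f`-flavour Wilson–Dirac matrix is flavour-diagonal. [cite: MontvayMunster1994, §5.1.1 (5.4)–(5.5)] -/
theorem diracMatrix_of_flavour_ne (U : GaugeConfig 4 S (Matrix.specialUnitaryGroup (Fin 3) ℂ))
    (mq : Fin Nf → ℝ) {i j : FermiIdx Nf S} (h : (quarkEquiv.symm i).1 ≠ (quarkEquiv.symm j).1) :
    diracMatrix U mq i j = 0 := by
  simp [diracMatrix, h]

/-- **Invariance of the fermionic Boltzmann factor** `exp(−ψ̄D(U)ψ)` under the vector flavour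
torus, for arbitrary flavour-dependent masses `m_f`. [cite: MontvayMunster1994, §5.1.1 (5.6)] -/
theorem fermiFlavourScale_fermiBoltzmann {t : Fin Nf → ℂ} (ht : ∀ f, t f ≠ 0)
    (U : GaugeConfig 4 S (Matrix.specialUnitaryGroup (Fin 3) ℂ)) (mq : Fin Nf → ℝ) :
    fermiFlavourScale t (fermiBoltzmann U mq) = fermiBoltzmann U mq := by
  rw [fermiBoltzmann, grassmannExp,
    map_isNilpotentExp_of_injective _ (fermiFlavourScale_injective ht),
    fermiFlavourScale_quadratic ht]
  exact fun i j hij => by rw [Matrix.neg_apply, diracMatrix_of_flavour_ne U mq hij, neg_zero]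

/-- **Exact vector flavour symmetry of the lattice QCD expectation** (Ward identity of the torus
`U(1)^{N_f} ⊂ U(N_f)_V`): for every Grassmann-valued function `X` of the gauge field and every
`t ∈ (ℂˣ)^{N_f}`, `⟨t · X⟩ = ⟨X⟩` on every torus, at every `β` and all bare masses `m_f`
(the Wilson–Dirac action is flavour-diagonal and the Berezin measure is invariant). [cite: MontvayMunster1994, §5.1.1 (5.6)] -/
theorem qcdTorusExpect_fermiFlavourScale {t : Fin Nf → ℂ} (ht : ∀ f, t f ≠ 0) (β : ℝ)
    (mq : Fin Nf → ℝ)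
    (X : GaugeConfig 4 S (Matrix.specialUnitaryGroup (Fin 3) ℂ) → FermiAlg Nf S) :
    qcdTorusExpect β S mq (fun U => fermiFlavourScale t (X U)) = qcdTorusExpect β S mq X := by
  unfold qcdTorusExpect
  congr 2
  funext U
  conv_lhs => rw [← fermiFlavourScale_fermiBoltzmann ht U mq, ← map_mul,
    fermiIntegral_fermiFlavourScale ht]

/-- The lattice QCD expectation is homogeneous in the observable. [folklore] -/
theorem qcdTorusExpect_smul (c : ℂ) (β : ℝ) (mq : Fin Nf → ℝ)
    (X : GaugeConfig 4 S (Matrix.specialUnitaryGroup (Fin 3) ℂ) → FermiAlg Nf S) :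
    qcdTorusExpect β S mq (fun U => c • X U) = c * qcdTorusExpect β S mq X := by
  unfold qcdTorusExpect
  rw [mul_div_assoc', ← MeasureTheory.integral_const_mul]
  congr 2
  funext U
  rw [smul_mul_assoc, map_smul, smul_eq_mul]

/-- **Flavour selection rule**: an observable of definite non-zero flavour charge — `t · X = c X`
with `c ≠ 1` for some `t ∈ (ℂˣ)^{N_f}` — has vanishing lattice QCD expectation on every torus
(e.g. a single flavoured meson `ψ̄_u Γ ψ_d`, a baryon). [cite: MontvayMunster1994, §5.1.1 (5.6)] -/
theorem qcdTorusExpect_eq_zero_of_fermiFlavourScale {t : Fin Nf → ℂ} (ht : ∀ f, t f ≠ 0)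
    {c : ℂ} (hc : c ≠ 1) (β : ℝ) (mq : Fin Nf → ℝ)
    (X : GaugeConfig 4 S (Matrix.specialUnitaryGroup (Fin 3) ℂ) → FermiAlg Nf S)
    (hX : ∀ U, fermiFlavourScale t (X U) = c • X U) : qcdTorusExpect β S mq X = 0 := by
  have h := qcdTorusExpect_fermiFlavourScale ht β mq X
  simp_rw [hX, qcdTorusExpect_smul] at h
  have h' : (c - 1) * qcdTorusExpect β S mq X = 0 := by rw [sub_mul, one_mul, h, sub_self]
  rcases mul_eq_zero.1 h' with h1 | h1
  · exact absurd (sub_eq_zero.1 h1) hc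
  · exact h1

/-- **The torus placement intertwines the two torus actions**: scaling the flavours of
`A.onTorus S v U` is placing the flavour-scaled `A.F`. [cite: OsterwalderSeiler1978, §2] -/
theorem fermiFlavourScale_onTorus (A : QCDLatticeObservable Nf R)
    (v : _root_.Literature.Probability.LatticeModels.Site 4)
    (U : GaugeConfig 4 S (Matrix.specialUnitaryGroup (Fin 3) ℂ)) :
    fermiFlavourScale t (A.onTorus S v U) =
      ExteriorAlgebra.map
        (Fintype.linearCombination ℂ fun w =>
          Pi.single (QCDLatticeObservable.toTorusIdx (Nf := Nf) (R := R) S v w) (1 : ℂ))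
        (QCDLatticeObservable.flavourScale t (A.F (configShift (-v) (torusLift S U)))) := by
  rw [QCDLatticeObservable.onTorus, ← AlgHom.comp_apply, ← AlgHom.comp_apply,
    fermiFlavourScale, QCDLatticeObservable.flavourScale_eq, ExteriorAlgebra.map_comp_map,
    ExteriorAlgebra.map_comp_map]
  congr 2
  refine LinearMap.pi_ext' fun w => LinearMap.ext_ring ?_
  simp only [LinearMap.comp_apply, LinearMap.coe_single]
  rw [Fintype.linearCombination_apply_single, one_smul, pi_diag_single, pi_diag_single,
    map_smul, Fintype.linearCombination_apply_single, one_smul]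
  congr 1
  induction w using lex_sum_ind with
  | hl a => simp [QCDLatticeObservable.toTorusIdx]
  | hr b => simp [QCDLatticeObservable.toTorusIdx]

/-- **A flavour-neutral observable, placed on any torus, is fixed by the torus action.** [cite: MontvayMunster1994, §5.1.1 (5.6)] [cite: OsterwalderSeiler1978, §2] -/
theorem QCDLatticeObservable.IsFlavourNeutral.fermiFlavourScale_onTorus
    {A : QCDLatticeObservable Nf R} (hA : A.IsFlavourNeutral) {t : Fin Nf → ℂ}
    (ht : ∀ f, t f ≠ 0) (v : _root_.Literature.Probability.LatticeModels.Site 4)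
    (U : GaugeConfig 4 S (Matrix.specialUnitaryGroup (Fin 3) ℂ)) :
    fermiFlavourScale t (A.onTorus S v U) = A.onTorus S v U := by
  rw [_root_.Literature.MathematicalPhysics.QuantumFieldTheory.fermiFlavourScale_onTorus,
    hA t ht, QCDLatticeObservable.onTorus]

end Torus

end Literature.MathematicalPhysics.QuantumFieldTheory

end
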